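import Summits.QuantumFields.YangMills.Theorems.UnitScaleTiltProp7QprimeCombBumpSectionRows
import HarnessLib

/-!
# Prop. 7 on T³ — lane II [I-9] hinge lemmas: CUTOFF OPERATORS READ POINTWISE

Route `UnitScaleTilt`, crux `MinimiserStabilityRegPr` (stmt-QuantumFields-19200), E′ growth side, lane II «divergence recovery at the curved regular member».
The member geometry file composes px11 g6's cutoff operators `Zs c`∕`Zb c` (✓`exists_cutoffPackage`, (Z2): `toL2S⁻¹(Zs c φ) x = ζ c x • toL2S⁻¹φ x`,
`toL2⁻¹(Zb c f) b = ζ c b.src • toL2⁻¹f b`) with px12 g7's chart-local potentials ((B8-member), rows stated on the chart box).  The generic hinge: a linear map on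
the member's `L²` spaces that READS as multiplication by a real weight `ζ` (i) only sees its argument on `{ζ ≠ 0}` (`congr` lemmas — so (R1) can be fed
`𝟙_A·φ`, and `hDφ` follows from the INSIDE-chart identity `y − r = D_Wφ`), and (ii) for `0 ≤ ζ ≤ 1` has `‖Z f‖² ≤ c₀·Σ_{x ∈ S} ‖f x‖_F²` for any `S ⊇ {ζ ≠ 0}`
(the `K_c`, `Φt_c`, `ρ_c` readings); the site norm formula is routeR-w3 g8's ✓`Prop7DivRecoveryCoarseRows.norm_sq_toL2S_eq` (inlined as a proof step here
while its olean is unbuilt — not re-declared).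

HONEST SCOPE.  Linear-algebra bookkeeping; nothing of (REC)∕hN06∕the crux is proved here; YM₃ on T³ is rung R3 — NOT d = 4, NOT infinite volume, NOT a mass gap, NOT Clay.
[cite: Balaban1985BackgroundPropagators, (3.3) p.391, (3.19) p.393]
-/

noncomputable section

open scoped InnerProductSpace Matrix.Norms.L2Operator BigOperators

namespace Summit.QuantumFields.YangMills.Theorems.Prop7DivRecoveryCutoffReadings

open Literature.MathematicalPhysics.QuantumFieldTheory.Balaban1983to89
open Literature.MathematicalPhysics.QuantumFieldTheory.Balaban1983to89.T3ContinuumYM3Torus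
open B11Eq103H1Complex (SiteL2K BondL2K)
open Summit.QuantumFields.YangMills.Theorems.Prop7SectET3Transport (periodsT3)
open Summit.QuantumFields.YangMills.Theorems.Prop7SectET3HilbertLetters (W₂ frobEquiv toL2 toL2S inner_frobEquiv_symm)
open Summit.QuantumFields.YangMills.Theorems.Prop7DeltaEtaAlmostPositive (norm_toL2_sq)

variable (F : T3Family) (K : ℕ) (c₀ : ℝ) [hc : Fact (0 < c₀)]

/-! ## §1 Norms read pointwise -/

/-- `frobEquiv⁻¹` commutes with a real scalar. -/
theorem frobEquiv_symm_real_smul (t : ℝ) (M : Matrix (Fin 2) (Fin 2) ℂ) :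
    (frobEquiv.symm (t • M) : W₂) = t • (frobEquiv.symm M : W₂) := by
  rw [← Complex.coe_smul, LinearEquiv.map_smul, Complex.coe_smul]

/-- `‖frobEquiv⁻¹(t • M)‖² = t²·‖frobEquiv⁻¹ M‖²`. -/
theorem norm_sq_frobEquiv_symm_real_smul (t : ℝ) (M : Matrix (Fin 2) (Fin 2) ℂ) :
    ‖(frobEquiv.symm (t • M) : W₂)‖ ^ 2 = t ^ 2 * ‖(frobEquiv.symm M : W₂)‖ ^ 2 := by
  rw [frobEquiv_symm_real_smul, norm_smul, Real.norm_eq_abs, mul_pow, sq_abs]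

/-! ## §2 Operators that read as multiplication by a real weight: congruence -/

omit hc in
/-- ★ **SITE CUTOFF CONGRUENCE**: a linear `Z` reading as `ζ`-multiplication only sees its argument where `ζ ≠ 0`. -/
theorem siteCutoff_congr (Z : SiteL2K ℂ 3 (periodsT3 F K) c₀ W₂ →ₗ[ℂ] SiteL2K ℂ 3 (periodsT3 F K) c₀ W₂) (ζ : Site (F.P K) 0 → ℝ)
    (hZ : ∀ φ x, (toL2S F K c₀).symm (Z φ) x = ζ x • (toL2S F K c₀).symm φ x)
    {f g : SiteL2K ℂ 3 (periodsT3 F K) c₀ W₂} (hfg : ∀ x, ζ x ≠ 0 → (toL2S F K c₀).symm f x = (toL2S F K c₀).symm g x) :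
    Z f = Z g := by
  apply (toL2S F K c₀).symm.injective
  funext x
  rw [hZ, hZ]
  by_cases hx : ζ x = 0
  · rw [hx, zero_smul, zero_smul]
  · rw [hfg x hx]

omit hc in
/-- ★ **BOND CUTOFF CONGRUENCE**: a linear `ZE` reading as `ξ`-multiplication on bonds only sees its argument where `ξ ≠ 0`. -/
theorem bondCutoff_congr (ZE : BondL2K ℂ 3 (periodsT3 F K) c₀ W₂ →ₗ[ℂ] BondL2K ℂ 3 (periodsT3 F K) c₀ W₂) (ξ : PBond (F.P K) 0 → ℝ)
    (hZE : ∀ f b, (toL2 F K c₀).symm (ZE f) b = ξ b • (toL2 F K c₀).symm f b)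
    {f g : BondL2K ℂ 3 (periodsT3 F K) c₀ W₂} (hfg : ∀ b, ξ b ≠ 0 → (toL2 F K c₀).symm f b = (toL2 F K c₀).symm g b) :
    ZE f = ZE g := by
  apply (toL2 F K c₀).symm.injective
  funext b
  rw [hZE, hZE]
  by_cases hb : ξ b = 0
  · rw [hb, zero_smul, zero_smul]
  · rw [hfg b hb]

omit hc in
/-- The three-term form used for `hDφ`: if `y − r = Dφ` wherever `ξ ≠ 0` then `ZE(Dφ) = ZE y − ZE r`. -/
theorem bondCutoff_eq_sub (ZE : BondL2K ℂ 3 (periodsT3 F K) c₀ W₂ →ₗ[ℂ] BondL2K ℂ 3 (periodsT3 F K) c₀ W₂) (ξ : PBond (F.P K) 0 → ℝ)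
    (hZE : ∀ f b, (toL2 F K c₀).symm (ZE f) b = ξ b • (toL2 F K c₀).symm f b)
    {d y r : BondL2K ℂ 3 (periodsT3 F K) c₀ W₂}
    (h : ∀ b, ξ b ≠ 0 → (toL2 F K c₀).symm d b = (toL2 F K c₀).symm y b - (toL2 F K c₀).symm r b) :
    ZE d = ZE y - ZE r := by
  rw [← map_sub]
  refine bondCutoff_congr F K c₀ ZE ξ hZE fun b hb => ?_
  rw [h b hb, map_sub, Pi.sub_apply]

omit hc in
/-- The additive form used for `hloc`: `v = Δφ + κ` ⟹ `Z v = Z(Δφ) + Z κ` (plain linearity, recorded for the knit). -/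
theorem siteCutoff_of_eq_add (Z : SiteL2K ℂ 3 (periodsT3 F K) c₀ W₂ →ₗ[ℂ] SiteL2K ℂ 3 (periodsT3 F K) c₀ W₂)
    {v a k : SiteL2K ℂ 3 (periodsT3 F K) c₀ W₂} (h : v = a + k) : Z v = Z a + Z k := by
  rw [h, map_add]

/-! ## §3 Operators that read as multiplication by a weight in `[0,1]`: norm bounds -/

/-- ★ **SITE CUTOFF NORM BOUND**: `0 ≤ ζ ≤ 1`, `{ζ ≠ 0} ⊆ S` ⟹ `‖Z f‖² ≤ c₀·Σ_{x∈S} ‖f x‖_F²`. -/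
theorem norm_sq_siteCutoff_le (Z : SiteL2K ℂ 3 (periodsT3 F K) c₀ W₂ →ₗ[ℂ] SiteL2K ℂ 3 (periodsT3 F K) c₀ W₂) (ζ : Site (F.P K) 0 → ℝ)
    (hZ : ∀ φ x, (toL2S F K c₀).symm (Z φ) x = ζ x • (toL2S F K c₀).symm φ x)
    (h01 : ∀ x, 0 ≤ ζ x ∧ ζ x ≤ 1) (S : Finset (Site (F.P K) 0)) (hS : ∀ x, ζ x ≠ 0 → x ∈ S)
    (f : SiteL2K ℂ 3 (periodsT3 F K) c₀ W₂) :
    ‖Z f‖ ^ 2 ≤ c₀ * ∑ x ∈ S, ‖(frobEquiv.symm ((toL2S F K c₀).symm f x) : W₂)‖ ^ 2 := by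
  classical
  have hc0 : 0 < c₀ := hc.out
  have hnormS : ∀ l : Site (F.P K) 0 → Matrix (Fin 2) (Fin 2) ℂ,
      ‖toL2S F K c₀ l‖ ^ 2 = c₀ * ∑ x : Site (F.P K) 0, ‖(frobEquiv.symm (l x) : W₂)‖ ^ 2 := by
    intro l
    have h := Summit.QuantumFields.YangMills.Theorems.Prop7SectET3RealCoordSums.inner_toL2S (F := F) (K := K) (c₀ := c₀) l l
    rw [← inner_self_eq_norm_sq (𝕜 := ℂ), h]
    simp only [RCLike.re_to_complex, Complex.re_ofReal_mul]
    congr 1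
    rw [Complex.re_sum]
    refine Finset.sum_congr rfl fun x _ => ?_
    rw [← inner_frobEquiv_symm, ← inner_self_eq_norm_sq (𝕜 := ℂ)]
    rfl
  have hZf : Z f = toL2S F K c₀ ((toL2S F K c₀).symm (Z f)) := (LinearEquiv.apply_symm_apply _ _).symm
  rw [hZf, hnormS]
  refine mul_le_mul_of_nonneg_left ?_ hc0.le
  have hpt : ∀ x : Site (F.P K) 0, ‖(frobEquiv.symm ((toL2S F K c₀).symm (Z f) x) : W₂)‖ ^ 2
      = ζ x ^ 2 * ‖(frobEquiv.symm ((toL2S F K c₀).symm f x) : W₂)‖ ^ 2 := fun x => by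
    rw [hZ, norm_sq_frobEquiv_symm_real_smul]
  simp only [hpt]
  calc ∑ x : Site (F.P K) 0, ζ x ^ 2 * ‖(frobEquiv.symm ((toL2S F K c₀).symm f x) : W₂)‖ ^ 2
      = ∑ x ∈ S, ζ x ^ 2 * ‖(frobEquiv.symm ((toL2S F K c₀).symm f x) : W₂)‖ ^ 2 := by
        rw [← Finset.sum_subset (Finset.subset_univ S)]
        intro x _ hx
        have : ζ x = 0 := by
          by_contra h
          exact hx (hS x h)
        rw [this]; ring
    _ ≤ ∑ x ∈ S, ‖(frobEquiv.symm ((toL2S F K c₀).symm f x) : W₂)‖ ^ 2 := by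
        refine Finset.sum_le_sum fun x _ => ?_
        have h1 : ζ x ^ 2 ≤ 1 := by
          have := h01 x
          nlinarith
        have h0 : 0 ≤ ‖(frobEquiv.symm ((toL2S F K c₀).symm f x) : W₂)‖ ^ 2 := sq_nonneg _
        nlinarith

/-- ★ **BOND CUTOFF NORM BOUND**: `0 ≤ ξ ≤ 1`, `{ξ ≠ 0} ⊆ S` ⟹ `‖ZE f‖² ≤ c₀·Σ_{b∈S} ‖f b‖_F²`. -/
theorem norm_sq_bondCutoff_le (ZE : BondL2K ℂ 3 (periodsT3 F K) c₀ W₂ →ₗ[ℂ] BondL2K ℂ 3 (periodsT3 F K) c₀ W₂) (ξ : PBond (F.P K) 0 → ℝ)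
    (hZE : ∀ f b, (toL2 F K c₀).symm (ZE f) b = ξ b • (toL2 F K c₀).symm f b)
    (h01 : ∀ b, 0 ≤ ξ b ∧ ξ b ≤ 1) (S : Finset (PBond (F.P K) 0)) (hS : ∀ b, ξ b ≠ 0 → b ∈ S)
    (f : BondL2K ℂ 3 (periodsT3 F K) c₀ W₂) :
    ‖ZE f‖ ^ 2 ≤ c₀ * ∑ b ∈ S, ‖(frobEquiv.symm ((toL2 F K c₀).symm f b) : W₂)‖ ^ 2 := by
  classical
  have hc0 : 0 < c₀ := hc.out
  have hZf : ZE f = toL2 F K c₀ ((toL2 F K c₀).symm (ZE f)) := (LinearEquiv.apply_symm_apply _ _).symm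
  rw [hZf, norm_toL2_sq (F := F) (K := K) (c₀ := c₀)]
  refine mul_le_mul_of_nonneg_left ?_ hc0.le
  have hpt : ∀ b : PBond (F.P K) 0, ‖(frobEquiv.symm ((toL2 F K c₀).symm (ZE f) b) : W₂)‖ ^ 2
      = ξ b ^ 2 * ‖(frobEquiv.symm ((toL2 F K c₀).symm f b) : W₂)‖ ^ 2 := fun b => by
    rw [hZE, norm_sq_frobEquiv_symm_real_smul]
  simp only [hpt]
  calc ∑ b : PBond (F.P K) 0, ξ b ^ 2 * ‖(frobEquiv.symm ((toL2 F K c₀).symm f b) : W₂)‖ ^ 2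
      = ∑ b ∈ S, ξ b ^ 2 * ‖(frobEquiv.symm ((toL2 F K c₀).symm f b) : W₂)‖ ^ 2 := by
        rw [← Finset.sum_subset (Finset.subset_univ S)]
        intro b _ hb
        have : ξ b = 0 := by
          by_contra h
          exact hb (hS b h)
        rw [this]; ring
    _ ≤ ∑ b ∈ S, ‖(frobEquiv.symm ((toL2 F K c₀).symm f b) : W₂)‖ ^ 2 := by
        refine Finset.sum_le_sum fun b _ => ?_
        have h1 : ξ b ^ 2 ≤ 1 := by
          have := h01 b
          nlinarith
        have h0 : 0 ≤ ‖(frobEquiv.symm ((toL2 F K c₀).symm f b) : W₂)‖ ^ 2 := sq_nonneg _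
        nlinarith

/-- The unweighted specialisations: `‖f‖²` dominates every cutoff, `‖Z f‖² ≤ ‖f‖²` and `‖ZE f‖² ≤ ‖f‖²`. -/
theorem norm_sq_siteCutoff_le_norm_sq (Z : SiteL2K ℂ 3 (periodsT3 F K) c₀ W₂ →ₗ[ℂ] SiteL2K ℂ 3 (periodsT3 F K) c₀ W₂) (ζ : Site (F.P K) 0 → ℝ)
    (hZ : ∀ φ x, (toL2S F K c₀).symm (Z φ) x = ζ x • (toL2S F K c₀).symm φ x)
    (h01 : ∀ x, 0 ≤ ζ x ∧ ζ x ≤ 1) (f : SiteL2K ℂ 3 (periodsT3 F K) c₀ W₂) : ‖Z f‖ ^ 2 ≤ ‖f‖ ^ 2 := by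
  classical
  have h := norm_sq_siteCutoff_le F K c₀ Z ζ hZ h01 Finset.univ (fun x _ => Finset.mem_univ x) f
  have hnormS : ∀ l : Site (F.P K) 0 → Matrix (Fin 2) (Fin 2) ℂ,
      ‖toL2S F K c₀ l‖ ^ 2 = c₀ * ∑ x : Site (F.P K) 0, ‖(frobEquiv.symm (l x) : W₂)‖ ^ 2 := by
    intro l
    have h := Summit.QuantumFields.YangMills.Theorems.Prop7SectET3RealCoordSums.inner_toL2S (F := F) (K := K) (c₀ := c₀) l l
    rw [← inner_self_eq_norm_sq (𝕜 := ℂ), h]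
    simp only [RCLike.re_to_complex, Complex.re_ofReal_mul]
    congr 1
    rw [Complex.re_sum]
    refine Finset.sum_congr rfl fun x _ => ?_
    rw [← inner_frobEquiv_symm, ← inner_self_eq_norm_sq (𝕜 := ℂ)]
    rfl
  have hf : ‖f‖ ^ 2 = c₀ * ∑ x : Site (F.P K) 0, ‖(frobEquiv.symm ((toL2S F K c₀).symm f x) : W₂)‖ ^ 2 := by
    conv_lhs => rw [← (toL2S F K c₀).apply_symm_apply f]
    exact hnormS _
  rw [hf]; exact h

/-- `‖ZE f‖² ≤ ‖f‖²` for a bond cutoff with weights in `[0,1]`. -/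
theorem norm_sq_bondCutoff_le_norm_sq (ZE : BondL2K ℂ 3 (periodsT3 F K) c₀ W₂ →ₗ[ℂ] BondL2K ℂ 3 (periodsT3 F K) c₀ W₂) (ξ : PBond (F.P K) 0 → ℝ)
    (hZE : ∀ f b, (toL2 F K c₀).symm (ZE f) b = ξ b • (toL2 F K c₀).symm f b)
    (h01 : ∀ b, 0 ≤ ξ b ∧ ξ b ≤ 1) (f : BondL2K ℂ 3 (periodsT3 F K) c₀ W₂) : ‖ZE f‖ ^ 2 ≤ ‖f‖ ^ 2 := by
  classical
  have h := norm_sq_bondCutoff_le F K c₀ ZE ξ hZE h01 Finset.univ (fun b _ => Finset.mem_univ b) f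
  have hf : ‖f‖ ^ 2 = c₀ * ∑ b : PBond (F.P K) 0, ‖(frobEquiv.symm ((toL2 F K c₀).symm f b) : W₂)‖ ^ 2 := by
    conv_lhs => rw [← (toL2 F K c₀).apply_symm_apply f]
    exact norm_toL2_sq (F := F) (K := K) (c₀ := c₀) _
  rw [hf]; exact h

/-! ## §4 The per-patch α-group of [I-9]: (B8-member)'s chart rows read through the cutoffs

Every lemma is generic in the chart data `(c, z, R)` (the knit reads all patches in ONE base chart `c = basePt F n K` with patch-dependent
boxes, px9 g7's half-block finding) and takes px12's (B8-member) conjuncts AS HYPOTHESES, with the chart-side quantities abstracted to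
functions `g`, `k`, `Y`, `G` (instantiated at the knit by `conjR (V w μ) (φ_Z (w + e_μ)) − φ_Z w`, `η⁻¹•R(u w)⁻¹m`, `toL2⁻¹y`, …). -/

section PatchAlpha

open B10Eq27TorusAxialLog (transl)
open B4Eq19LatticeOperators (Zd box unitVec)
open Summit.QuantumFields.YangMills.Theorems.Prop7SectET3HilbertLetters (DL2 DstarL2 covLapSite)
open Summit.QuantumFields.YangMills.Theorems.Prop7RieszTauFrobNorm (norm_sq_frobEquiv_symm)

/-- ★ **(hloc_c)**: the global identity `D*_W y = Δ_W φ_c + κs_c` ((B8-member) (hloc)) read through the site cutoff `Z_c`. -/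
theorem patch_hloc (n : ℕ) (W : GaugeField (F.P K) 0 (Matrix.specialUnitaryGroup (Fin 2) ℂ))
    (Z : SiteL2K ℂ 3 (periodsT3 F K) c₀ W₂ →ₗ[ℂ] SiteL2K ℂ 3 (periodsT3 F K) c₀ W₂)
    {y : BondL2K ℂ 3 (periodsT3 F K) c₀ W₂} {φ κs : SiteL2K ℂ 3 (periodsT3 F K) c₀ W₂}
    (hloc : DstarL2 F n K c₀ W y = covLapSite F n K c₀ W φ + κs) :
    Z (DstarL2 F n K c₀ W y) = Z (covLapSite F n K c₀ W φ) + Z κs :=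
  siteCutoff_of_eq_add F K c₀ Z hloc

/-- ★★ **(hDφ_c)**: if the bond cutoff `ZE_c` reads as `ξ`-multiplication with `ξ` supported on INSIDE-chart bonds of the box, then (B8-member)'s
(S2b) `r = 𝟙_{inside}·(y − ∇φ_Z)` and (D) `D_Wφ = ∇φ_Z` on inside bonds give `ZE_c (D_W φ_c) = ZE_c y − ZE_c r_c`. -/
theorem patch_hDφ (n : ℕ) (W : GaugeField (F.P K) 0 (Matrix.specialUnitaryGroup (Fin 2) ℂ))
    (ZE : BondL2K ℂ 3 (periodsT3 F K) c₀ W₂ →ₗ[ℂ] BondL2K ℂ 3 (periodsT3 F K) c₀ W₂) (ξ : PBond (F.P K) 0 → ℝ)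
    (hZE : ∀ f b, (toL2 F K c₀).symm (ZE f) b = ξ b • (toL2 F K c₀).symm f b)
    (c : Site (F.P K) 0) (z : Zd (F.P K).d) (R : ℤ)
    (hξ : ∀ b, ξ b ≠ 0 → ∃ w ∈ box z R, transl c w = b.src ∧ w + unitVec b.dir ∈ box z R)
    (g : Zd (F.P K).d → Fin (F.P K).d → Matrix (Fin 2) (Fin 2) ℂ)
    {y r : BondL2K ℂ 3 (periodsT3 F K) c₀ W₂} {φ : SiteL2K ℂ 3 (periodsT3 F K) c₀ W₂}
    (hS2b : ∀ w ∈ box z R, ∀ μ, (toL2 F K c₀).symm r ⟨transl c w, μ⟩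
        = if w + unitVec μ ∈ box z R then (toL2 F K c₀).symm y ⟨transl c w, μ⟩ - g w μ else 0)
    (hD : ∀ w ∈ box z R, ∀ μ, w + unitVec μ ∈ box z R → (toL2 F K c₀).symm (DL2 F n K c₀ W φ) ⟨transl c w, μ⟩ = g w μ) :
    ZE (DL2 F n K c₀ W φ) = ZE y - ZE r := by
  refine bondCutoff_eq_sub F K c₀ ZE ξ hZE fun b hb => ?_
  obtain ⟨w, hw, hsrc, hwμ⟩ := hξ b hb
  obtain ⟨src, μ⟩ := b
  dsimp only at hsrc hwμ
  subst hsrc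
  rw [hD w hw μ hwμ, hS2b w hw μ, if_pos hwμ, sub_sub_cancel]

/-- The chart-side bond energies are nonnegative (used to split (B8-member)'s Pythagoras (h1) into two bounds). -/
theorem boxBondSum_nonneg (z : Zd (F.P K).d) (R : ℤ) (G : Zd (F.P K).d → Fin (F.P K).d → Matrix (Fin 2) (Fin 2) ℂ) :
    0 ≤ c₀ * ∑ w ∈ box z R, ∑ μ, (if w + unitVec μ ∈ box z R then ∑ j : Fin 2, ∑ k : Fin 2, ‖(G w μ) j k‖ ^ 2 else 0) := by
  refine mul_nonneg hc.out.le (Finset.sum_nonneg fun w _ => Finset.sum_nonneg fun μ _ => ?_)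
  split_ifs
  · exact Finset.sum_nonneg fun _ _ => Finset.sum_nonneg fun _ _ => sq_nonneg _
  · exact le_rfl

/-- ★ **(h1_c)**: (B8-member)'s Pythagoras `N_c = Gφ_c + ρ_c` read as the two budget rows `Gφ_c ≤ N_c`, `ρ_c ≤ N_c`. -/
theorem patch_h1 (z : Zd (F.P K).d) (R : ℤ) (Y G : Zd (F.P K).d → Fin (F.P K).d → Matrix (Fin 2) (Fin 2) ℂ) {ρ : ℝ} (hρ : 0 ≤ ρ)
    (h8 : c₀ * ∑ w ∈ box z R, ∑ μ, (if w + unitVec μ ∈ box z R then ∑ j : Fin 2, ∑ k : Fin 2, ‖(Y w μ) j k‖ ^ 2 else 0)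
        = c₀ * ∑ w ∈ box z R, ∑ μ, (if w + unitVec μ ∈ box z R then ∑ j : Fin 2, ∑ k : Fin 2, ‖(G w μ) j k‖ ^ 2 else 0) + ρ) :
    c₀ * ∑ w ∈ box z R, ∑ μ, (if w + unitVec μ ∈ box z R then ∑ j : Fin 2, ∑ k : Fin 2, ‖(G w μ) j k‖ ^ 2 else 0)
        ≤ c₀ * ∑ w ∈ box z R, ∑ μ, (if w + unitVec μ ∈ box z R then ∑ j : Fin 2, ∑ k : Fin 2, ‖(Y w μ) j k‖ ^ 2 else 0) ∧
      ρ ≤ c₀ * ∑ w ∈ box z R, ∑ μ, (if w + unitVec μ ∈ box z R then ∑ j : Fin 2, ∑ k : Fin 2, ‖(Y w μ) j k‖ ^ 2 else 0) := by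
  have hG := boxBondSum_nonneg F K c₀ z R G
  constructor <;> linarith

/-- ★★ **(hK_c) — THE SOURCE READING**: a site cutoff `Z_c` (`0 ≤ ζ ≤ 1`) supported on the chart image of `s` (e.g. `Q_{R−1}(z)`), a chart-side
formula `κs_c (transl c w) = k w` on `s` ((B8-member) (L1)) and a bound on `c₀Σ_{w∈s}‖k w‖_F²` ((B8-member) (h3)) give `‖Z_c κs_c‖² ≤` that bound. -/
theorem patch_hK (Z : SiteL2K ℂ 3 (periodsT3 F K) c₀ W₂ →ₗ[ℂ] SiteL2K ℂ 3 (periodsT3 F K) c₀ W₂) (ζ : Site (F.P K) 0 → ℝ)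
    (hZ : ∀ φ x, (toL2S F K c₀).symm (Z φ) x = ζ x • (toL2S F K c₀).symm φ x) (h01 : ∀ x, 0 ≤ ζ x ∧ ζ x ≤ 1)
    (c : Site (F.P K) 0) (s : Finset (Zd (F.P K).d)) (hinj : Set.InjOn (transl c) ↑s)
    (hζ : ∀ x, ζ x ≠ 0 → ∃ w ∈ s, transl c w = x)
    (κs : SiteL2K ℂ 3 (periodsT3 F K) c₀ W₂) (k : Zd (F.P K).d → Matrix (Fin 2) (Fin 2) ℂ)
    (h7 : ∀ w ∈ s, (toL2S F K c₀).symm κs (transl c w) = k w) {B : ℝ}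
    (h10 : c₀ * ∑ w ∈ s, ∑ j : Fin 2, ∑ k' : Fin 2, ‖(k w) j k'‖ ^ 2 ≤ B) :
    ‖Z κs‖ ^ 2 ≤ B := by
  classical
  have hS : ∀ x, ζ x ≠ 0 → x ∈ s.image (transl c) := fun x hx => by
    obtain ⟨w, hw, hx'⟩ := hζ x hx
    exact Finset.mem_image.mpr ⟨w, hw, hx'⟩
  refine (norm_sq_siteCutoff_le F K c₀ Z ζ hZ h01 (s.image (transl c)) hS κs).trans (le_of_eq_of_le ?_ h10)
  rw [Finset.sum_image hinj]
  congr 1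
  refine Finset.sum_congr rfl fun w hw => ?_
  rw [h7 w hw, norm_sq_frobEquiv_symm]

/-- ★★ **(hN_c) — THE LOCAL BOND ENERGY READ ON THE TORUS**: with the chart injective on the box, (B8-member)'s chart-side energy
`c₀Σ_{w∈Q_R}Σ_μ 𝟙[w+e_μ ∈ Q_R]‖Y⟨transl c w, μ⟩‖_F²` is at most `c₀Σ_{b∈T}‖Y b‖_F²` for any bond set `T` containing the inside-chart bonds
(the `N_c` letters of the family budget; summing over patches then costs the overlap multiplicity of the `T_c`). -/
theorem patch_hN (c : Site (F.P K) 0) (z : Zd (F.P K).d) (R : ℤ) (hinj : Set.InjOn (transl c) ↑(box z R))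
    (Y : PBond (F.P K) 0 → Matrix (Fin 2) (Fin 2) ℂ) (T : Finset (PBond (F.P K) 0))
    (hT : ∀ w ∈ box z R, ∀ μ, w + unitVec μ ∈ box z R → (⟨transl c w, μ⟩ : PBond (F.P K) 0) ∈ T) :
    c₀ * ∑ w ∈ box z R, ∑ μ, (if w + unitVec μ ∈ box z R then ∑ j : Fin 2, ∑ k : Fin 2, ‖(Y ⟨transl c w, μ⟩) j k‖ ^ 2 else 0)
      ≤ c₀ * ∑ b ∈ T, ‖(frobEquiv.symm (Y b) : W₂)‖ ^ 2 := by
  classical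
  refine mul_le_mul_of_nonneg_left ?_ hc.out.le
  set P := ((box z R) ×ˢ (Finset.univ : Finset (Fin (F.P K).d))).filter (fun p => p.1 + unitVec p.2 ∈ box z R) with hP
  set e : Zd (F.P K).d × Fin (F.P K).d → PBond (F.P K) 0 := fun p => ⟨transl c p.1, p.2⟩ with he
  have e1 : ∑ w ∈ box z R, ∑ μ, (if w + unitVec μ ∈ box z R then ∑ j : Fin 2, ∑ k : Fin 2, ‖(Y ⟨transl c w, μ⟩) j k‖ ^ 2 else 0)
      = ∑ p ∈ P, ‖(frobEquiv.symm (Y (e p)) : W₂)‖ ^ 2 := by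
    rw [hP, Finset.sum_filter, Finset.sum_product]
    refine Finset.sum_congr rfl fun w _ => Finset.sum_congr rfl fun μ _ => ?_
    split_ifs
    · rw [norm_sq_frobEquiv_symm]
    · rfl
  have hinjP : Set.InjOn e ↑P := by
    intro p hp q hq hpq
    have hp1 : p.1 ∈ box z R := (Finset.mem_product.mp (Finset.mem_filter.mp hp).1).1
    have hq1 : q.1 ∈ box z R := (Finset.mem_product.mp (Finset.mem_filter.mp hq).1).1
    have h1 : transl c p.1 = transl c q.1 := congrArg PBond.src hpq
    have h2 : p.2 = q.2 := congrArg PBond.dir hpq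
    exact Prod.ext (hinj hp1 hq1 h1) h2
  have hsub : P.image e ⊆ T := by
    intro b hb
    obtain ⟨p, hp, rfl⟩ := Finset.mem_image.mp hb
    have hp' := Finset.mem_filter.mp hp
    exact hT p.1 (Finset.mem_product.mp hp'.1).1 p.2 hp'.2
  have e2 : ∑ p ∈ P, ‖(frobEquiv.symm (Y (e p)) : W₂)‖ ^ 2 = ∑ b ∈ P.image e, ‖(frobEquiv.symm (Y b) : W₂)‖ ^ 2 :=
    (Finset.sum_image (f := fun b => ‖(frobEquiv.symm (Y b) : W₂)‖ ^ 2) hinjP).symm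
  rw [e1, e2]
  exact Finset.sum_le_sum_of_subset_of_nonneg hsub fun b _ _ => sq_nonneg _

end PatchAlpha

/-! ## §5 The member's currency facts: `η·ℓ = 1`, `1 ≤ R₀ℓ`, `R_f ≤ 4R₀ℓ`

The chart bricks speak in `(R_f, η, ℓ, α, d)`, the budget in `(R₀ = L^s, e)`; the generic conversions are ✓`Prop7DivRecoveryAssemblyBudgetW4.currency_*`,
and these three member facts are their side conditions (`ℓ = L^{K−n}`, `η = eta F n K = (L⁻¹)^{K−n}`, `R_f` = px9 g7's record radius). -/

section MemberCurrency

open T3SectALandauChart (eta)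

omit hc in
/-- ★ `η·ℓ = 1`: `eta F n K · L^{K−n} = 1` — what makes every lane-II window `K`-uniform. -/
theorem eta_mul_level (n : ℕ) : eta F n K * (F.L : ℝ) ^ (K - n) = 1 := by
  have hL0 : F.L ≠ 0 := by have := F.hL.2; omega
  have hL : (F.L : ℝ) ≠ 0 := Nat.cast_ne_zero.mpr hL0
  rw [eta, ← mul_pow, inv_mul_cancel₀ hL, one_pow]

omit hc in
/-- `1 ≤ R₀·ℓ` (`R₀ = L^s`, `ℓ = L^{K−n}`, `L > 1`). -/
theorem one_le_radius_mul_level (n s : ℕ) : 1 ≤ (F.L : ℝ) ^ s * (F.L : ℝ) ^ (K - n) := by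
  have hL1 : (1 : ℝ) ≤ F.L := by exact_mod_cast F.hL.2.le
  exact one_le_mul_of_one_le_of_one_le (one_le_pow₀ hL1) (one_le_pow₀ hL1)

omit hc in
/-- ★ The record chart radius `R_f = (2L^s + 1)·ℓ + (ℓ − 1)/2` (px9 g7's letters, integer division) is at most `4·L^s·ℓ` as a real. -/
theorem recordRadius_le (n s : ℕ) :
    (((2 * ((F.L ^ s : ℕ) : ℤ) + 1) * ((F.L ^ (K - n) : ℕ) : ℤ) + (((F.L ^ (K - n) : ℕ) : ℤ) - 1) / 2 : ℤ) : ℝ)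
      ≤ 4 * (F.L : ℝ) ^ s * (F.L : ℝ) ^ (K - n) := by
  have hL : 0 < F.L := by have := F.hL.2; omega
  have hR1 : 1 ≤ F.L ^ s := Nat.one_le_pow _ _ hL
  have hint : ((2 * ((F.L ^ s : ℕ) : ℤ) + 1) * ((F.L ^ (K - n) : ℕ) : ℤ) + (((F.L ^ (K - n) : ℕ) : ℤ) - 1) / 2 : ℤ)
      ≤ 4 * ((F.L ^ s : ℕ) : ℤ) * ((F.L ^ (K - n) : ℕ) : ℤ) := by
    have h1 : (((F.L ^ (K - n) : ℕ) : ℤ) - 1) / 2 ≤ ((F.L ^ (K - n) : ℕ) : ℤ) := by omega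
    have hR1' : (1 : ℤ) ≤ ((F.L ^ s : ℕ) : ℤ) := by exact_mod_cast hR1
    have hℓ0 : (0 : ℤ) ≤ ((F.L ^ (K - n) : ℕ) : ℤ) := by positivity
    nlinarith [mul_nonneg (sub_nonneg.mpr hR1') hℓ0]
  have hcast : (4 : ℝ) * (F.L : ℝ) ^ s * (F.L : ℝ) ^ (K - n) = ((4 * ((F.L ^ s : ℕ) : ℤ) * ((F.L ^ (K - n) : ℕ) : ℤ) : ℤ) : ℝ) := by
    push_cast; ring
  rw [hcast]
  exact_mod_cast hint

omit hc in
/-- The record chart radius is nonnegative. -/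
theorem recordRadius_nonneg (n s : ℕ) :
    (0 : ℝ) ≤ (((2 * ((F.L ^ s : ℕ) : ℤ) + 1) * ((F.L ^ (K - n) : ℕ) : ℤ) + (((F.L ^ (K - n) : ℕ) : ℤ) - 1) / 2 : ℤ) : ℝ) := by
  have hL : 0 < F.L := by have := F.hL.2; omega
  have hℓ1 : 1 ≤ F.L ^ (K - n) := Nat.one_le_pow _ _ hL
  have hint : (0 : ℤ) ≤ (2 * ((F.L ^ s : ℕ) : ℤ) + 1) * ((F.L ^ (K - n) : ℕ) : ℤ) + (((F.L ^ (K - n) : ℕ) : ℤ) - 1) / 2 := by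
    have hℓ1' : (1 : ℤ) ≤ ((F.L ^ (K - n) : ℕ) : ℤ) := by exact_mod_cast hℓ1
    have h2 : (0 : ℤ) ≤ (((F.L ^ (K - n) : ℕ) : ℤ) - 1) / 2 := by omega
    have hR0 : (0 : ℤ) ≤ ((F.L ^ s : ℕ) : ℤ) := by positivity
    nlinarith
  exact_mod_cast hint

end MemberCurrency

end Summit.QuantumFields.YangMills.Theorems.Prop7DivRecoveryCutoffReadings

end
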